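import Summits.QuantumFields.YangMills.Theorems.SwapVirialDeficitZeroModeGroupThreeSmallBallRatePerHub
import Summits.QuantumFields.YangMills.Theorems.SwapVirialDeficitZeroModeExactPairBall
import HarnessLib

/-!
# Exact zero-mode rung Z4 in SMALL-BALL form — VIII: the hub integrals (polar cap by radial integration, bulk by the per-hub bound)
# (LEAD ym-line-sfw-p2 g93 07:46Z «`Haar³{N₃(t)} = v₃t⁴(1 + O(t^θ))`»; free-hands support of ⟨stmt-QuantumFields-24197⟩)

The symmetric difference `S_s Δ S₀` of the triple events (`S_s = {(a,x,y) | (x,y) ∈ G_s(axisPoint a)}`) is integrated over the hub `a` (cone measure):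
* §17 POLAR CAP `‖Im a‖ ≤ m`: both events are dominated by `e³·dominator ‖Im a‖` (part IV) whose double integral is `≤ 4(π²/48)(‖Im a‖²)^{-4/3}I(⅓)²`
  (w2 g55 ✓`lintegral_dominator_le`); by radial integration in the chart `ℝ³` (w3 g62 ✓`ZeroModeExact.lintegral_chart_radial`)
  ★ `lintegral_cone_cap_rpow_le` — `∫_{‖Im a‖ ≤ m} (‖Im a‖²)^{-4/3} dcone ≤ coneConst·2·4π·3·m^{1/3}`;
* §18 BULK `‖Im a‖ > m`: the per-hub bound of part VII-c gives `(vol⊗vol)(G_sΔG₀)(axisPoint a) ≤ (√s/m⁶)·K`;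
* §19 ★★ `measure_symmDiff_triple_le` — `μ(S_s Δ S₀) ≤ A·m^{1/3} + (√s/m⁶)·K` for all `0 < s ≤ 1`, `0 < m ≤ 1`.
Part IX: `m = s^{3/38}` and the rate `|Haar³(N₃(t))/t⁴ − v₃′| ≤ K′·t^{1/19}`.
HONEST LABEL: finite-dimensional measure theory (plan-level zero-mode rung of a DRAFT line); NOT ⟨24197⟩; the Yang–Mills mass gap is NOT proved; no summit
is proved by a line.  Seat ym-line-fcl-p3 g44, `--supports stmt-QuantumFields-24197`.  THEOREMS ONLY, standard axioms.
References: [cite: GonzalezarroyoAltes1988]; [cite: Vanbaal2001]; [folklore].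
-/

set_option autoImplicit false

noncomputable section

open MeasureTheory Quaternion Set Filter Topology
open scoped Quaternion ENNReal BigOperators Topology
open Literature.MathematicalPhysics.QuantumLattice
open Summit.QuantumFields.YangMills.Theorems.SwapTwistDeficit.ToronLog

attribute [local instance] Literature.Analysis.FluidPDE.Tao2016.quatMeasurableSpace
  Literature.Analysis.FluidPDE.Tao2016.quatBorelSpace
  Literature.MathematicalPhysics.QuantumLattice.secondCountableTopology_su2

namespace Summit.QuantumFields.YangMills.Theorems.SwapVirialDeficit.ZeroModeGroup

/-! ## §17 The polar cap by radial integration -/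

/-- `∫_{(0,m]} r^{−2/3} dr = 3·m^{1/3}` as a Lebesgue integral (`m > 0`). [folklore] -/
theorem lintegral_Ioc_rpow_neg_two_thirds {m : ℝ} (hm : 0 < m) :
    ∫⁻ r in Set.Ioc (0 : ℝ) m, ENNReal.ofReal (r ^ (-(2 / 3 : ℝ))) = ENNReal.ofReal (3 * m ^ ((1 : ℝ) / 3)) := by
  have hint : IntegrableOn (fun r : ℝ => r ^ (-(2 / 3 : ℝ))) (Set.Ioc 0 m) := by
    have h := (intervalIntegral.integrableOn_Ioo_rpow_iff hm).2 (by norm_num : (-1 : ℝ) < -(2 / 3 : ℝ))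
    exact h.congr_set_ae Ioo_ae_eq_Ioc.symm
  rw [← ofReal_integral_eq_lintegral_ofReal hint (ae_restrict_of_forall_mem measurableSet_Ioc fun r hr => Real.rpow_nonneg hr.1.le _),
    ← intervalIntegral.integral_of_le hm.le, integral_rpow (Or.inl (by norm_num))]
  congr 1
  rw [Real.zero_rpow (by norm_num), sub_zero]
  norm_num
  ring

/-- The radial profile of the cap: for `r > 0`, `r²·𝟙{r² ≤ m²}·(r²)^{−4/3} = 𝟙{r ≤ m}·r^{−2/3}`. [folklore] -/
theorem cap_profile {m r : ℝ} (hm : 0 < m) (hr : 0 < r) :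
    ENNReal.ofReal (r ^ 2) * (Set.Iic (m ^ 2)).indicator (fun σ : ℝ => ENNReal.ofReal (σ ^ (-(4 / 3 : ℝ)))) (r ^ 2) =
      (Set.Ioc (0 : ℝ) m).indicator (fun r : ℝ => ENNReal.ofReal (r ^ (-(2 / 3 : ℝ)))) r := by
  by_cases h : r ≤ m
  · have h2 : r ^ 2 ∈ Set.Iic (m ^ 2) := by
      simp only [Set.mem_Iic]; exact pow_le_pow_left₀ hr.le h 2
    rw [Set.indicator_of_mem h2, Set.indicator_of_mem (show r ∈ Set.Ioc (0 : ℝ) m from ⟨hr, h⟩),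
      ← ENNReal.ofReal_mul (sq_nonneg _)]
    congr 1
    rw [← Real.rpow_natCast r 2, ← Real.rpow_mul hr.le, ← Real.rpow_add hr]
    norm_num
  · have h2 : r ^ 2 ∉ Set.Iic (m ^ 2) := by
      simp only [Set.mem_Iic, not_le]; exact pow_lt_pow_left₀ (not_le.1 h) hm.le two_ne_zero
    rw [Set.indicator_of_notMem h2, Set.indicator_of_notMem (fun hh => h hh.2), mul_zero]

/-- ★ **The cap integral in the chart**: `∫_{ℝ³} 𝟙{|v|² ≤ m²}·(|v|²)^{−4/3} dv = 4π·3·m^{1/3}` (`m > 0`; w3 g62's radial formula). [folklore] -/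
theorem lintegral_chart_cap {m : ℝ} (hm : 0 < m) :
    ∫⁻ v : Fin 3 → ℝ, (Set.Iic (m ^ 2)).indicator (fun σ : ℝ => ENNReal.ofReal (σ ^ (-(4 / 3 : ℝ)))) (∑ i, v i ^ 2) =
      ENNReal.ofReal (4 * Real.pi) * ENNReal.ofReal (3 * m ^ ((1 : ℝ) / 3)) := by
  have hf : Measurable fun σ : ℝ => (Set.Iic (m ^ 2)).indicator (fun σ : ℝ => ENNReal.ofReal (σ ^ (-(4 / 3 : ℝ)))) σ :=
    (ENNReal.measurable_ofReal.comp ((measurable_id (α := ℝ)).pow_const (-(4 / 3 : ℝ)))).indicator measurableSet_Iic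
  rw [ZeroModeExact.lintegral_chart_radial _ hf]
  congr 1
  calc ∫⁻ r in Set.Ioi (0 : ℝ), ENNReal.ofReal (r ^ 2) * (Set.Iic (m ^ 2)).indicator (fun σ : ℝ => ENNReal.ofReal (σ ^ (-(4 / 3 : ℝ)))) (r ^ 2)
      = ∫⁻ r in Set.Ioi (0 : ℝ), (Set.Ioc (0 : ℝ) m).indicator (fun r : ℝ => ENNReal.ofReal (r ^ (-(2 / 3 : ℝ)))) r :=
        setLIntegral_congr_fun (measurableSet_Ioi : MeasurableSet (Set.Ioi (0 : ℝ))) (fun r hr => cap_profile hm hr)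
    _ = ∫⁻ r in Set.Ioc (0 : ℝ) m, ENNReal.ofReal (r ^ (-(2 / 3 : ℝ))) := by
        rw [lintegral_indicator (measurableSet_Ioc : MeasurableSet (Set.Ioc (0 : ℝ) m)), Measure.restrict_restrict measurableSet_Ioc,
          Set.inter_eq_left.2 Set.Ioc_subset_Ioi_self]
    _ = ENNReal.ofReal (3 * m ^ ((1 : ℝ) / 3)) := lintegral_Ioc_rpow_neg_two_thirds hm

/-- `‖Im a‖² = Σᵢ ((quatReImEquiv a).2 i)²`. [folklore] -/
theorem sq_norm_im_eq_sum (a : ℍ) : ‖a.im‖ ^ 2 = ∑ i, ((quatReImEquiv a).2 i) ^ 2 := by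
  rw [WeakCouplingRates.sq_norm_im, quatReImEquiv_apply, Fin.sum_univ_three]
  simp

/-- ★ **THE POLAR CAP**: `∫_{‖Im a‖ ≤ m} (‖Im a‖²)^{−4/3} dcone(a) ≤ coneConst·(2·(4π·3m^{1/3}))` (`m > 0`): the cone measure is `coneConst·` Lebesgue on
the ball, the ball lies in `{a₀² < 1} × ℝ³`, and the `ℝ³`-integral is the cap integral. [folklore] -/
theorem lintegral_cone_cap_rpow_le {m : ℝ} (hm : 0 < m) :
    ∫⁻ a, {a : ℍ | ‖a.im‖ ≤ m}.indicator (fun a => ENNReal.ofReal ((‖a.im‖ ^ 2) ^ (-(4 / 3 : ℝ)))) a ∂coneMeasure ≤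
      ENNReal.ofReal coneConst * (2 * (ENNReal.ofReal (4 * Real.pi) * ENNReal.ofReal (3 * m ^ ((1 : ℝ) / 3)))) := by
  set G : (Fin 3 → ℝ) → ℝ≥0∞ := fun v => (Set.Iic (m ^ 2)).indicator (fun σ : ℝ => ENNReal.ofReal (σ ^ (-(4 / 3 : ℝ)))) (∑ i, v i ^ 2) with hG
  have hGm : Measurable G :=
    ((ENNReal.measurable_ofReal.comp ((measurable_id (α := ℝ)).pow_const (-(4 / 3 : ℝ)))).indicator
      (measurableSet_Iic : MeasurableSet (Set.Iic (m ^ 2)))).comp (by fun_prop)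
  set H : ℝ × (Fin 3 → ℝ) → ℝ≥0∞ := fun p => {u : ℝ | u ^ 2 < 1}.indicator (fun _ => (1 : ℝ≥0∞)) p.1 * G p.2 with hH
  have hHm : Measurable H := ((measurable_const.indicator (measurableSet_sqLt 1)).comp measurable_fst).mul
    (hGm.comp measurable_snd)
  rw [lintegral_coneMeasure_eq]
  gcongr
  -- pointwise on `ℍ`: the ball indicator times the cap weight is dominated by `H ∘ quatReImEquiv`
  have hpt : ∀ a : ℍ, (Metric.ball (0 : ℍ) 1).indicator
      (fun a => {a : ℍ | ‖a.im‖ ≤ m}.indicator (fun a => ENNReal.ofReal ((‖a.im‖ ^ 2) ^ (-(4 / 3 : ℝ)))) a) a ≤ H (quatReImEquiv a) := by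
    intro a
    by_cases hb : a ∈ Metric.ball (0 : ℍ) 1
    · rw [Set.indicator_of_mem hb]
      have hre : a.re ^ 2 < 1 := by
        have h1 : ‖a‖ < 1 := by simpa using hb
        have h2 : a.re ^ 2 ≤ ‖a‖ ^ 2 := by rw [sq_norm_eq_sum_sq]; nlinarith [sq_nonneg a.imI, sq_nonneg a.imJ, sq_nonneg a.imK]
        nlinarith [norm_nonneg a]
      rw [hH]; simp only [quatReImEquiv_apply]
      rw [Set.indicator_of_mem (show a.re ∈ {u : ℝ | u ^ 2 < 1} from hre), one_mul, hG]
      simp only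
      by_cases hcap : a ∈ {a : ℍ | ‖a.im‖ ≤ m}
      · rw [Set.indicator_of_mem hcap]
        have hsum : ∑ i, (![a.imI, a.imJ, a.imK] i) ^ 2 = ‖a.im‖ ^ 2 := by
          rw [WeakCouplingRates.sq_norm_im, Fin.sum_univ_three]; simp
        rw [hsum, Set.indicator_of_mem]
        simp only [Set.mem_Iic]
        exact pow_le_pow_left₀ (norm_nonneg _) hcap 2
      · rw [Set.indicator_of_notMem hcap]; exact bot_le
    · rw [Set.indicator_of_notMem hb]; exact bot_le
  calc ∫⁻ a, (Metric.ball (0 : ℍ) 1).indicator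
        (fun a => {a : ℍ | ‖a.im‖ ≤ m}.indicator (fun a => ENNReal.ofReal ((‖a.im‖ ^ 2) ^ (-(4 / 3 : ℝ)))) a) a
      ≤ ∫⁻ a, H (quatReImEquiv a) := lintegral_mono hpt
    _ = ∫⁻ p, H p := measurePreserving_quatReImEquiv.lintegral_comp hHm
    _ = (∫⁻ u : ℝ, {u : ℝ | u ^ 2 < 1}.indicator (fun _ => (1 : ℝ≥0∞)) u) * ∫⁻ v, G v := by
        rw [hH, show (volume : Measure (ℝ × (Fin 3 → ℝ))) = (volume : Measure ℝ).prod volume from rfl]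
        exact lintegral_prod_mul (measurable_const.indicator (measurableSet_sqLt 1)).aemeasurable
          hGm.aemeasurable
    _ = 2 * (ENNReal.ofReal (4 * Real.pi) * ENNReal.ofReal (3 * m ^ ((1 : ℝ) / 3))) := by
        rw [lintegral_indicator_const (measurableSet_sqLt 1), volume_sqBox_one, one_mul, hG,
          lintegral_chart_cap hm]


/-! ## §18 Per-hub bounds on the triple space -/

/-- The rescaled event has `vol ⊗ vol`-mass at most `e³·∫∫ dominator a_I` (`s ≥ 0`, `‖a‖ ≤ 1`; part IV's domination, integrated). [folklore] -/
theorem measure_rescaledSet_le_lintegral_dominator {s : ℝ} (hs : 0 ≤ s) {a : ℍ} (ha : ‖a‖ ≤ 1) :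
    ((volume : Measure ℍ).prod (volume : Measure ℍ)) (rescaledSet s a) ≤
      ENNReal.ofReal (Real.exp 3) * ∫⁻ z, dominator a.imI z.1 z.2 ∂((volume : Measure ℍ).prod (volume : Measure ℍ)) := by
  rw [← lintegral_indicator_one (measurableSet_rescaledSet s a), ← lintegral_const_mul' _ _ ENNReal.ofReal_ne_top]
  refine lintegral_mono fun z => ?_
  exact indicator_rescaledSet_le_dominator hs ha z.1 z.2

/-- ★ **Power bound per hub**: `(vol⊗vol)(G_s(a)) ≤ C_d·(a_I²)^{−4/3}` with `C_d = e³·4·(π²/48)·I(⅓)²` (`s ≥ 0`, `‖a‖ ≤ 1`, `a_I > 0`; w2 g55's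
✓`lintegral_dominator_le`). [folklore] -/
theorem measure_rescaledSet_le_rpow {s : ℝ} (hs : 0 ≤ s) {a : ℍ} (ha : ‖a‖ ≤ 1) (hr : 0 < a.imI) :
    ((volume : Measure ℍ).prod (volume : Measure ℍ)) (rescaledSet s a) ≤
      (ENNReal.ofReal (Real.exp 3) * (4 * (ENNReal.ofReal (Real.pi ^ 2 / 48) * (Ising (1/3) * Ising (1/3))))) *
        ENNReal.ofReal ((a.imI ^ 2) ^ (-(4 / 3 : ℝ))) := by
  refine (measure_rescaledSet_le_lintegral_dominator hs ha).trans ?_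
  have h := lintegral_dominator_le (r := a.imI) hr
  rw [ENNReal.ofReal_mul (by positivity : (0 : ℝ) ≤ Real.pi ^ 2 / 48)] at h
  calc ENNReal.ofReal (Real.exp 3) * ∫⁻ z, dominator a.imI z.1 z.2 ∂((volume : Measure ℍ).prod (volume : Measure ℍ))
      ≤ ENNReal.ofReal (Real.exp 3) * (4 * (ENNReal.ofReal (Real.pi ^ 2 / 48) * ENNReal.ofReal ((a.imI ^ 2) ^ (-(4 / 3 : ℝ))) *
          (Ising (1/3) * Ising (1/3)))) := mul_le_mul' le_rfl h
    _ = _ := by ring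

/-- The symmetric-difference event on the triple space (hub first) is measurable. [folklore] -/
theorem measurableSet_symmDiff_triple (s : ℝ) :
    MeasurableSet {q : ℍ × ℍ × ℍ | ((q.2.1, q.2.2) ∈ rescaledSet s (axisPoint q.1) ∧ (q.2.1, q.2.2) ∉ rescaledSet 0 (axisPoint q.1)) ∨
      ((q.2.1, q.2.2) ∈ rescaledSet 0 (axisPoint q.1) ∧ (q.2.1, q.2.2) ∉ rescaledSet s (axisPoint q.1))} := by
  have hs := measurableSet_rescaledSet_axis_joint s
  have h0 := measurableSet_rescaledSet_axis_joint 0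
  exact (hs.inter h0.compl).union (h0.inter hs.compl)

/-- The hub integral of the symmetric difference, by sections. [folklore] -/
theorem measure_symmDiff_triple_eq_lintegral (s : ℝ) :
    (coneMeasure.prod ((volume : Measure ℍ).prod (volume : Measure ℍ)))
        {q : ℍ × ℍ × ℍ | ((q.2.1, q.2.2) ∈ rescaledSet s (axisPoint q.1) ∧ (q.2.1, q.2.2) ∉ rescaledSet 0 (axisPoint q.1)) ∨
          ((q.2.1, q.2.2) ∈ rescaledSet 0 (axisPoint q.1) ∧ (q.2.1, q.2.2) ∉ rescaledSet s (axisPoint q.1))} =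
      ∫⁻ a, ((volume : Measure ℍ).prod (volume : Measure ℍ))
        {z : ℍ × ℍ | (z ∈ rescaledSet s (axisPoint a) ∧ z ∉ rescaledSet 0 (axisPoint a)) ∨
          (z ∈ rescaledSet 0 (axisPoint a) ∧ z ∉ rescaledSet s (axisPoint a))} ∂coneMeasure := by
  haveI := isProbabilityMeasure_coneMeasure
  rw [Measure.prod_apply (measurableSet_symmDiff_triple s)]
  rfl

/-- Cone-almost every hub lies in the open unit ball and off the real axis. [folklore] -/
theorem ae_cone_ball_and_im_ne_zero : ∀ᵐ a : ℍ ∂coneMeasure, ‖a‖ < 1 ∧ a.im ≠ 0 := by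
  haveI := isProbabilityMeasure_coneMeasure
  have hball : ∀ᵐ a : ℍ ∂coneMeasure, ‖a‖ < 1 := by
    rw [ae_iff]
    have e : {a : ℍ | ¬‖a‖ < 1} = (Metric.ball (0 : ℍ) 1)ᶜ := by ext a; simp
    rw [e]; exact SigmaTwistedCeiling.coneMeasure_compl_ball
  filter_upwards [hball, ae_coneQ_ne_zero] with a h1 h2
  refine ⟨h1, fun him => h2 ?_⟩
  have hJ : a.imJ = 0 := by have h := Quaternion.imJ_im a; rw [him] at h; simpa using h.symm
  have hK : a.imK = 0 := by have h := Quaternion.imK_im a; rw [him] at h; simpa using h.symm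
  have hI : a.imI = 0 := by have h := Quaternion.imI_im a; rw [him] at h; simpa using h.symm
  have hn : ‖a.im‖ = 0 := by rw [him, norm_zero]
  ext <;> simp [coneQ, hJ, hK, hI, hn]

/-! ## §19 The hub integral of the symmetric difference: polar cap + bulk -/

/-- ★★ **`μ(S_s Δ S₀) ≤ A·m^{1/3}-term + (√s/m⁶)·K`** for `0 < s ≤ 1`, `0 < m`: the polar cap `‖Im a‖ ≤ m` by domination and radial
integration, the bulk by the per-hub layer bound of part VII-c. [folklore] -/
theorem measure_symmDiff_triple_le {s m : ℝ} (hs0 : 0 < s) (hs1 : s ≤ 1) (hm0 : 0 < m) :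
    (coneMeasure.prod ((volume : Measure ℍ).prod (volume : Measure ℍ)))
        {q : ℍ × ℍ × ℍ | ((q.2.1, q.2.2) ∈ rescaledSet s (axisPoint q.1) ∧ (q.2.1, q.2.2) ∉ rescaledSet 0 (axisPoint q.1)) ∨
          ((q.2.1, q.2.2) ∈ rescaledSet 0 (axisPoint q.1) ∧ (q.2.1, q.2.2) ∉ rescaledSet s (axisPoint q.1))} ≤
      (2 * (ENNReal.ofReal (Real.exp 3) * (4 * (ENNReal.ofReal (Real.pi ^ 2 / 48) * (Ising (1/3) * Ising (1/3)))))) *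
          (ENNReal.ofReal coneConst * (2 * (ENNReal.ofReal (4 * Real.pi) * ENNReal.ofReal (3 * m ^ ((1 : ℝ) / 3))))) +
        ENNReal.ofReal (Real.sqrt s / m ^ 6) * (ENNReal.ofReal 64 + ENNReal.ofReal (4 * Real.sqrt 2) * (Ising (1/4) * Ising (1/4))) := by
  haveI := isProbabilityMeasure_coneMeasure
  set Cd := ENNReal.ofReal (Real.exp 3) * (4 * (ENNReal.ofReal (Real.pi ^ 2 / 48) * (Ising (1/3) * Ising (1/3)))) with hCd
  set Kl := ENNReal.ofReal 64 + ENNReal.ofReal (4 * Real.sqrt 2) * (Ising (1/4) * Ising (1/4)) with hKl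
  rw [measure_symmDiff_triple_eq_lintegral]
  -- pointwise a.e. bound on the hub integrand
  have hpt : ∀ᵐ a : ℍ ∂coneMeasure, ((volume : Measure ℍ).prod (volume : Measure ℍ))
      {z : ℍ × ℍ | (z ∈ rescaledSet s (axisPoint a) ∧ z ∉ rescaledSet 0 (axisPoint a)) ∨
        (z ∈ rescaledSet 0 (axisPoint a) ∧ z ∉ rescaledSet s (axisPoint a))} ≤
      (2 * Cd) * {a : ℍ | ‖a.im‖ ≤ m}.indicator (fun a => ENNReal.ofReal ((‖a.im‖ ^ 2) ^ (-(4 / 3 : ℝ)))) a +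
        ENNReal.ofReal (Real.sqrt s / m ^ 6) * Kl := by
    filter_upwards [ae_cone_ball_and_im_ne_zero] with a ha
    obtain ⟨hball, him⟩ := ha
    have hr : 0 < (axisPoint a).imI := by
      show 0 < ‖a.im‖; exact norm_pos_iff.2 him
    have hna : ‖axisPoint a‖ ≤ 1 := by rw [norm_axisPoint]; exact hball.le
    obtain ⟨-, -, hJ, hK⟩ := axisPoint_components a
    by_cases hcap : ‖a.im‖ ≤ m
    · -- polar cap: both events are small
      have h1 := measure_rescaledSet_le_rpow hs0.le hna hr
      have h2 := measure_rescaledSet_le_rpow le_rfl hna hr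
      rw [Set.indicator_of_mem (show a ∈ {a : ℍ | ‖a.im‖ ≤ m} from hcap)]
      calc ((volume : Measure ℍ).prod (volume : Measure ℍ))
            {z : ℍ × ℍ | (z ∈ rescaledSet s (axisPoint a) ∧ z ∉ rescaledSet 0 (axisPoint a)) ∨
              (z ∈ rescaledSet 0 (axisPoint a) ∧ z ∉ rescaledSet s (axisPoint a))}
          ≤ ((volume : Measure ℍ).prod (volume : Measure ℍ)) (rescaledSet s (axisPoint a) ∪ rescaledSet 0 (axisPoint a)) := by
            refine measure_mono fun z hz => ?_
            rcases hz with ⟨h, -⟩ | ⟨h, -⟩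
            · exact Or.inl h
            · exact Or.inr h
        _ ≤ ((volume : Measure ℍ).prod (volume : Measure ℍ)) (rescaledSet s (axisPoint a)) +
              ((volume : Measure ℍ).prod (volume : Measure ℍ)) (rescaledSet 0 (axisPoint a)) := measure_union_le _ _
        _ ≤ Cd * ENNReal.ofReal (((axisPoint a).imI ^ 2) ^ (-(4 / 3 : ℝ))) + Cd * ENNReal.ofReal (((axisPoint a).imI ^ 2) ^ (-(4 / 3 : ℝ))) :=
            add_le_add h1 h2
        _ = (2 * Cd) * ENNReal.ofReal ((‖a.im‖ ^ 2) ^ (-(4 / 3 : ℝ))) := by rw [show (axisPoint a).imI = ‖a.im‖ from rfl]; ring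
        _ ≤ _ := le_self_add
    · -- bulk: the per-hub layer bound, and `r > m`
      have hgt : m < ‖a.im‖ := not_le.1 hcap
      have h := volume_symmDiff_rescaledSet_le hJ hK hr hna hs0 hs1
      rw [show (axisPoint a).imI = ‖a.im‖ from rfl] at h
      have hmono : ENNReal.ofReal (Real.sqrt s / ‖a.im‖ ^ 6) ≤ ENNReal.ofReal (Real.sqrt s / m ^ 6) := by
        refine ENNReal.ofReal_le_ofReal (div_le_div_of_nonneg_left (Real.sqrt_nonneg _) (by positivity) ?_)
        exact pow_le_pow_left₀ hm0.le hgt.le 6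
      calc _ ≤ ENNReal.ofReal (Real.sqrt s / ‖a.im‖ ^ 6) * Kl := h
        _ ≤ ENNReal.ofReal (Real.sqrt s / m ^ 6) * Kl := mul_le_mul' hmono le_rfl
        _ ≤ _ := le_add_self
  -- integrate
  have hmeas_cap : Measurable fun a : ℍ => {a : ℍ | ‖a.im‖ ≤ m}.indicator (fun a => ENNReal.ofReal ((‖a.im‖ ^ 2) ^ (-(4 / 3 : ℝ)))) a := by
    have hc : Measurable fun a : ℍ => ‖a.im‖ := (continuous_norm.comp Quaternion.continuous_im).measurable
    exact (ENNReal.measurable_ofReal.comp ((hc.pow_const 2).pow_const _)).indicator (measurableSet_le hc measurable_const)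
  calc ∫⁻ a, ((volume : Measure ℍ).prod (volume : Measure ℍ))
        {z : ℍ × ℍ | (z ∈ rescaledSet s (axisPoint a) ∧ z ∉ rescaledSet 0 (axisPoint a)) ∨
          (z ∈ rescaledSet 0 (axisPoint a) ∧ z ∉ rescaledSet s (axisPoint a))} ∂coneMeasure
      ≤ ∫⁻ a, ((2 * Cd) * {a : ℍ | ‖a.im‖ ≤ m}.indicator (fun a => ENNReal.ofReal ((‖a.im‖ ^ 2) ^ (-(4 / 3 : ℝ)))) a +
          ENNReal.ofReal (Real.sqrt s / m ^ 6) * Kl) ∂coneMeasure := lintegral_mono_ae hpt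
    _ = (2 * Cd) * ∫⁻ a, {a : ℍ | ‖a.im‖ ≤ m}.indicator (fun a => ENNReal.ofReal ((‖a.im‖ ^ 2) ^ (-(4 / 3 : ℝ)))) a ∂coneMeasure +
          ENNReal.ofReal (Real.sqrt s / m ^ 6) * Kl := by
        rw [lintegral_add_left (hmeas_cap.const_mul _), lintegral_const_mul _ hmeas_cap, lintegral_const, measure_univ, mul_one]
    _ ≤ (2 * Cd) * (ENNReal.ofReal coneConst * (2 * (ENNReal.ofReal (4 * Real.pi) * ENNReal.ofReal (3 * m ^ ((1 : ℝ) / 3))))) +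
          ENNReal.ofReal (Real.sqrt s / m ^ 6) * Kl := by
        gcongr
        exact lintegral_cone_cap_rpow_le hm0

end Summit.QuantumFields.YangMills.Theorems.SwapVirialDeficit.ZeroModeGroup

end
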